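import Summits.ResolutionOfSingularities.ResolutionOfSingularities.Theorems.PurelyInseparableDim4E2OfCJSAssemblyPrime
import Summits.ResolutionOfSingularities.ResolutionOfSingularities.Theorems.PurelyInseparableDim4RidgeResidual
import HarnessLib

/-!
# F4-I(p,p) FROM CJS THM 6.40 AND K2(p), EVERY PRIME `p ≥ 3`: `KeyTheorem640 → NoAboveFloorTrap p p → NoIsolatedTrap p p`
# (cell `res-dim4-pi`, the p-program closed against the ridge trichotomy)

[OURS · counted 0 · AI work weaker than expert review.]  Cell `res-dim4-pi` (D-0157 DOOR 2), seat res-dim4-p-1 g2; desk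
WORD #66 (the p-program), item (1) of holder res-dim4-p-2 g2's closing hand-over (l.≈2330 of the cell bus).  NOTHING here
proves Cossart–Jannsen–Saito's Theorem 6.40 (it enters as the NAMED FACT F-111 `KeyTheorem640_char_localized_isolated`, a
hypothesis), K2(p) = `NoAboveFloorTrap p p` for any `p ≥ 5` (a hypothesis), `NoIsolatedTrap p p` unconditionally, or
resolution of singularities in dimension ≥ 4 / characteristic `p`.

THE COMPOSITION.  res-dim4-p-12 g2's ridge trichotomy `RidgeBudget.noIsolatedTrap_of_residual (p) [Fact p.Prime] :
NoWideTrap p p → NoAboveFloorTrap p p → NoIsolatedTrap p p` (p661515; the narrow third is this seat's (N1)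
`RidgeBudget.narrowDrop`, p662631, inside it) composed with the p-program's
`E2OfCJS.noWideTrap_of_KeyTheorem640 (p) [Fact p.Prime] (hp3 : 3 ≤ p) : KeyTheorem640_char_localized_isolated → NoWideTrap p p`
(res-dim4-p-2 g2, p671312; rows by res-dim4-p-3/p-1/p-5/p-7/p-11 g2, base change p670597):

* **`noIsolatedTrap_of_KeyTheorem640_of_noAboveFloorTrap (p) [Fact p.Prime] (hp3 : 3 ≤ p)`** —
  `KeyTheorem640_char_localized_isolated → NoAboveFloorTrap p p → NoIsolatedTrap p p`: **F4-I(p,p) ⟸ F-111 ∧ K2(p)**; for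
  `p ≥ 5`, K2(p) is the ONLY open OURS letter of F4-I(p,p);
* `noIsolatedTrap_iff_noAboveFloorTrap_of_KeyTheorem640 (p) (hp3)` — under F-111, `NoIsolatedTrap p p ↔ NoAboveFloorTrap p p`;
* p = 3 sanity (not restated — `dedup.landed`): K2(3) is the tree's theorem `RidgeBudget.noAboveFloorTrap_three`, so
  `noIsolatedTrap_of_KeyTheorem640_of_noAboveFloorTrap 3 le_rfl hK640 noAboveFloorTrap_three : NoIsolatedTrap 3 3` is
  res-dim4-p-2 g2's landed `noIsolatedTrap_three_three_of_KeyTheorem640` (p669181) by a second kernel route.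

[DIM4 · CJS-ROW] consumed: F-111 only.  bears_on: LADDER-RESOLUTION:D157-DOOR2 (res-dim4-pi · F4-I(p,p) ⟸ F-111 ∧ K2(p)).
Supports stmt-ResolutionOfSingularities-16155 (helper).
-/

set_option linter.dupNamespace false

noncomputable section

open Literature.AlgebraicGeometry.CossartJannsenSaito2020

namespace Summit.ResolutionOfSingularities.ResolutionOfSingularities.Theorems.PIDim4

namespace E2OfCJS

open RidgeBudget (NoWideTrap NoAboveFloorTrap noIsolatedTrap_of_residual noAboveFloorTrap_of_noIsolatedTrap)

/-- **F4-I(p,p) ⟸ CJS Thm 6.40 ∧ K2(p), every prime `p ≥ 3`.**  If Cossart–Jannsen–Saito's Theorem 6.40 holds in its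
unit-wise localised isolated form (F-111) and there is no infinite isolated `Step0 p` chain avoiding order `p`
(K2(p) = `NoAboveFloorTrap p p`), then there is no infinite isolated `Step0 p` chain at all in the purely inseparable frame
`z^p + F(x₀,…,x₃)` of characteristic `p` (`NoIsolatedTrap p p`): the wide third is `noWideTrap_of_KeyTheorem640`, the
narrow third and the splitting are the ridge trichotomy `noIsolatedTrap_of_residual`.
[OURS · conditional on a NAMED PUBLISHED FACT and on K2(p)] [cite: CossartJannsenSaito2020, Thm. 6.40] -/
theorem noIsolatedTrap_of_KeyTheorem640_of_noAboveFloorTrap (p : ℕ) [Fact p.Prime] (hp3 : 3 ≤ p)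
    (hK640 : KeyTheorem640_char_localized_isolated.{0}) (hK2 : NoAboveFloorTrap p p) : NoIsolatedTrap p p :=
  noIsolatedTrap_of_residual p (noWideTrap_of_KeyTheorem640 p hp3 hK640) hK2

/-- **Under F-111, F4-I(p,p) IS K2(p)** (`p ≥ 3` prime): `NoIsolatedTrap p p ↔ NoAboveFloorTrap p p`.
[OURS · conditional on a NAMED PUBLISHED FACT] [cite: CossartJannsenSaito2020, Thm. 6.40] -/
theorem noIsolatedTrap_iff_noAboveFloorTrap_of_KeyTheorem640 (p : ℕ) [Fact p.Prime] (hp3 : 3 ≤ p)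
    (hK640 : KeyTheorem640_char_localized_isolated.{0}) : NoIsolatedTrap p p ↔ NoAboveFloorTrap p p :=
  ⟨noAboveFloorTrap_of_noIsolatedTrap p p, noIsolatedTrap_of_KeyTheorem640_of_noAboveFloorTrap p hp3 hK640⟩

end E2OfCJS

end Summit.ResolutionOfSingularities.ResolutionOfSingularities.Theorems.PIDim4

end
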